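import Summits.ResolutionOfSingularities.ResolutionOfSingularities.Theses.UniversalCells
import Summits.ResolutionOfSingularities.ResolutionOfSingularities.Theorems.UniversalCellsDefs
import Summits.ResolutionOfSingularities.ResolutionOfSingularities.Theorems.UniversalCellsMatroidCellResStubAffineNbhd
import Summits.ResolutionOfSingularities.ResolutionOfSingularities.Theorems.UniversalCellsMatroidCellResStubSaturateAway
import Literature.AlgebraicGeometry.Resolution.PrincipalizationToResolution
import Literature.AlgebraicGeometry.Resolution.ResolutionOfCurves
import HarnessLib

/-!
# The chart reduction of `UniversalCells.MatroidCellRes` (crux stmt-ResolutionOfSingularities-15230)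

`MatroidCellRes` (route `ResolutionOfSingularities/UniversalCells`, crux #2): for every prime `p`,
every `m`, every finite `Γ₊` and every `Γ₀`, every INTEGRAL scheme `W` open-immersed in the partial
matroid stratum `P(p,m,Γ₊,Γ₀) = Spec ((𝔽_p[a_ij : 3 × m] ⧸ (3 × 3 minors x_u of [I₃ | A], u ∈ Γ₀))[1/∏_{Γ₊} x_u])`
is pointwise-locally resolvable.

This file makes DURABLE the reduction worked out by the line `birth` of that crux
(`Cruxes/MatroidCellRes/Lines/birth.lean`, leads -0/c1/c2/c3): the crux follows from ANY "chart
engine" resolving the SATURATED INTEGRAL PRINCIPAL AFFINE CHARTS `Spec (Q_Γ)_g` of Γ-schemes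
(`Q_Γ = 𝔽_p[A] ⧸ (Γ-minors)`, `(Q_Γ)_g` a domain, `Γ` saturated on the chart: `u ∉ Γ ⇒ x_u ≠ 0`).
The two glue steps are the landed stubs `stub_affineNbhd` (p153751: an integral principal affine
chart `U ≅ D(f) ⊆ Z_{Γ₀}` around each point) and `stub_saturateAway` (p153762: `(Q_{Γ₀})_f ≃+* (Q_Γ)_g`
with `Γ ⊇ Γ₀` saturated on `D(g)`); the easy charts are peeled off unconditionally (regular charts
are their own resolution; charts of dimension `≤ 1` by normalisation, `hasResolution_of_dim_le_one`).

* `matroidCellRes_of_chartEngine` — crux ⇐ engine on all saturated integral charts;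
* `matroidCellRes_of_saturatedEngine` — crux ⇐ engine on the SINGULAR charts of dimension `≥ 2`
  (the honest residue of the crux: by Lafforgue's universality, in tree as
  `UniversalCells.Universality_proof`, these charts carry every singularity of finite type over
  `𝔽_p` up to a factor `𝔸ʳ`, so the hypothesis is resolution in characteristic `p` met on Hu's
  family; it is summit-implied, `saturatedEngine_of_resolutionOfSingularities`).

No definition is declared; the hypotheses are written inline over the route's abbreviations
`tautMatrix` / `minorIdeal` (`Theorems/UniversalCellsDefs.lean`, reducibly the crux's two `let`s).
The conditional forms through Hu's claim (Hu 2025 Thm. 1.3, integral Γ-schemes) and through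
Cossart–Piltant (dimension `≤ 3`) are in `UniversalCellsMatroidCellResChartReductionNamed.lean`.
-/

noncomputable section

-- single-problem summit: the doubled namespace component `ResolutionOfSingularities` is forced
set_option linter.dupNamespace false

open CategoryTheory AlgebraicGeometry Literature.AlgebraicGeometry.Resolution
open Summit.ResolutionOfSingularities.ResolutionOfSingularities.Theses.UniversalCells (MatroidCellRes)
open Summit.ResolutionOfSingularities.ResolutionOfSingularities.Theorems.UniversalCells
  (tautMatrix minorIdeal StratumRing)

namespace Summit.ResolutionOfSingularities.ResolutionOfSingularities.Theorems.MatroidCellRes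

/-! ## Principal affine charts of Γ-schemes: finite type, and the easy cases -/

/-- A principal open `Spec (𝔽_p[A] ⧸ I)_g` of a closed subscheme of `𝔸^{3m}_{𝔽_p}` is locally of
finite type over `𝔽_p` (quotient of a polynomial ring in `3m` variables, then a localisation away
from one element). [folklore] -/
theorem locallyOfFiniteType_away (p m : ℕ) (I : Ideal (MvPolynomial (Fin 3 × Fin m) (ZMod p)))
    (g : MvPolynomial (Fin 3 × Fin m) (ZMod p) ⧸ I) :
    LocallyOfFiniteType
      (Spec.map (CommRingCat.ofHom (algebraMap (ZMod p) (Localization.Away g)))) := by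
  rw [HasRingHomProperty.Spec_iff (P := @LocallyOfFiniteType)]
  have h1 : (algebraMap (ZMod p) (MvPolynomial (Fin 3 × Fin m) (ZMod p) ⧸ I)).FiniteType :=
    RingHom.finiteType_algebraMap.mpr inferInstance
  have h2 : (algebraMap (MvPolynomial (Fin 3 × Fin m) (ZMod p) ⧸ I)
      (Localization.Away g)).FiniteType :=
    RingHom.finiteType_holdsForLocalizationAway (Localization.Away g) g
  have h := h2.comp h1
  rw [← IsScalarTower.algebraMap_eq] at h
  simpa using h

/-- **Regular charts**: if `R` is a regular ring, `Spec R` is its own resolution. [folklore] -/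
theorem hasResolution_Spec_of_isRegularRing {R : Type} [CommRing R] (hreg : IsRegularRing R) :
    Scheme.HasResolution (Spec (.of R)) :=
  Scheme.IsRegular.hasResolution (Scheme.isRegular_Spec (.of R))

/-- **Curve charts**: an integral principal open `Spec (𝔽_p[A] ⧸ I)_g` of dimension `≤ 1` has a
resolution — normalisation of reduced curves of finite type over a field
(`hasResolution_of_dim_le_one`). [cite: Hartshorne1977, Ch. V Rem. 3.8.1] -/
theorem hasResolution_away_of_dim_le_one (p : ℕ) [Fact p.Prime] (m : ℕ)
    (I : Ideal (MvPolynomial (Fin 3 × Fin m) (ZMod p)))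
    (g : MvPolynomial (Fin 3 × Fin m) (ZMod p) ⧸ I) (hdom : IsDomain (Localization.Away g))
    (hdim : topologicalKrullDim (Spec (.of (Localization.Away g))) ≤ 1) :
    Scheme.HasResolution (Spec (.of (Localization.Away g))) := by
  haveI := locallyOfFiniteType_away p m I g
  haveI : _root_.IsReduced (Localization.Away g) := isReduced_of_noZeroDivisors
  haveI : IsReduced (Spec (.of (Localization.Away g))) := inferInstance
  exact hasResolution_of_dim_le_one (Spec (.of (Localization.Away g)))
    (Spec.map (CommRingCat.ofHom (algebraMap (ZMod p) (Localization.Away g)))) hdim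

/-- **The summit resolves every integral principal open of a closed subscheme of `𝔸^{3m}_{𝔽_p}`**
(a reduced, separated `𝔽_p`-scheme of finite type, to which `ResolutionInChar p` applies). Used to
certify that the engine hypotheses below are summit-implied. [folklore] -/
theorem hasResolution_away_of_resolutionOfSingularities (hS : _root_.ResolutionOfSingularities)
    (p : ℕ) (hp : p.Prime) (m : ℕ) (I : Ideal (MvPolynomial (Fin 3 × Fin m) (ZMod p)))
    (g : MvPolynomial (Fin 3 × Fin m) (ZMod p) ⧸ I) (hdom : IsDomain (Localization.Away g)) :
    Scheme.HasResolution (Spec (.of (Localization.Away g))) := by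
  haveI : Fact p.Prime := ⟨hp⟩
  let f : Spec (.of (Localization.Away g)) ⟶ Spec (.of (ZMod p)) :=
    Spec.map (CommRingCat.ofHom (algebraMap (ZMod p) (Localization.Away g)))
  haveI hft : LocallyOfFiniteType f := locallyOfFiniteType_away p m I g
  haveI : IsSeparated f := inferInstance
  haveI : QuasiCompact f := inferInstance
  haveI : _root_.IsReduced (Localization.Away g) := isReduced_of_noZeroDivisors
  haveI : IsReduced (Spec (.of (Localization.Away g))) := inferInstance
  exact hS p hp (ZMod p) (Spec (.of (Localization.Away g))) f ‹_› ‹_› ‹_› ‹_›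

/-! ## The chart reduction -/

/-- **`MatroidCellRes` from any chart engine** (PROVED; glue = the landed stubs `stub_affineNbhd`,
`stub_saturateAway`): if every SATURATED INTEGRAL PRINCIPAL AFFINE CHART `Spec (Q_Γ)_g` of a
Γ-scheme over `𝔽_p` (`(Q_Γ)_g` a domain, `u ∉ Γ ⇒ x_u ≠ 0 in (Q_Γ)_g`) has a resolution, then
`MatroidCellRes` holds. Proof: compose the open immersion `i : W → P(p,m,Γ₊,Γ₀)` with the
localisation open immersion `P(p,m,Γ₊,Γ₀) → Z_{Γ₀}` (so `Γ₊` disappears); `stub_affineNbhd` gives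
an open `U ∋ w` with an open immersion `e : U → Spec (Q_{Γ₀})_f`, `(Q_{Γ₀})_f` a domain;
`stub_saturateAway` gives `(Q_{Γ₀})_f ≃+* (Q_Γ)_g` with `Γ` saturated on `D(g)`; the engine resolves
`Spec (Q_Γ)_g`; the resolution transports back along `U → Spec (Q_{Γ₀})_f ≅ Spec (Q_Γ)_g`
(`Scheme.HasResolution.of_isOpenImmersion`), and `W' = U`. [folklore] -/
theorem matroidCellRes_of_chartEngine
    (hE : ∀ p : ℕ, p.Prime → ∀ (m : ℕ) (Γ : Set (Fin 3 → Fin 3 ⊕ Fin m))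
      (g : MvPolynomial (Fin 3 × Fin m) (ZMod p) ⧸ minorIdeal p m Γ),
      IsDomain (Localization.Away g) →
        (∀ u : Fin 3 → Fin 3 ⊕ Fin m, u ∉ Γ →
          algebraMap (MvPolynomial (Fin 3 × Fin m) (ZMod p) ⧸ minorIdeal p m Γ)
            (Localization.Away g)
            (Ideal.Quotient.mk (minorIdeal p m Γ) ((tautMatrix p m).submatrix id u).det) ≠ 0) →
        Scheme.HasResolution (Spec (.of (Localization.Away g)))) :
    MatroidCellRes := by
  intro p hp m Γp Γ0 M I W i hi hW w
  classical
  haveI : Fact p.Prime := ⟨hp⟩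
  haveI : IsOpenImmersion i := hi
  -- the localisation open immersion `P(p,m,Γ₊,Γ₀) → Z_{Γ₀}` and the composite `W → Z_{Γ₀}`
  let ιP : Spec (.of (StratumRing p m Γp Γ0)) ⟶
      Spec (.of (MvPolynomial (Fin 3 × Fin m) (ZMod p) ⧸ minorIdeal p m Γ0)) :=
    Spec.map (CommRingCat.ofHom (algebraMap (MvPolynomial (Fin 3 × Fin m) (ZMod p) ⧸
      minorIdeal p m Γ0) (StratumRing p m Γp Γ0)))
  haveI : IsOpenImmersion ιP :=
    IsOpenImmersion.of_isLocalization
      (Ideal.Quotient.mk (minorIdeal p m Γ0) (∏ u ∈ Γp, ((tautMatrix p m).submatrix id u).det))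
  have hj : IsOpenImmersion (i ≫ ιP) := inferInstance
  -- an integral principal affine chart around `w`
  obtain ⟨f, U, e, hwU, he, hdomf⟩ := stub_affineNbhd p m Γ0 W (i ≫ ιP) hj hW w
  -- saturate it
  obtain ⟨Γ, g, eRing, hdomg, hsat⟩ := stub_saturateAway p m Γ0 f hdomf
  -- the engine resolves the saturated chart
  have hres : Scheme.HasResolution (Spec (.of (Localization.Away g))) := hE p hp m Γ g hdomg hsat
  -- transport back to `U` along `U → Spec (Q_{Γ₀})_f ≅ Spec (Q_Γ)_g`
  let ι : Spec (.of (Localization.Away f)) ⟶ Spec (.of (Localization.Away g)) :=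
    Spec.map (eRing.symm.toCommRingCatIso).hom
  haveI : IsIso ι := inferInstance
  haveI : IsOpenImmersion e := he
  haveI : IsOpenImmersion (e ≫ ι) := inferInstance
  exact ⟨U, hwU, Scheme.HasResolution.of_isOpenImmersion (e ≫ ι) hres⟩

/-- **`MatroidCellRes` from the SATURATED ENGINE** (PROVED, unconditional): if every SINGULAR
saturated integral principal affine chart `Spec (Q_Γ)_g` of a Γ-scheme over `𝔽_p` of dimension
`≥ 2` (`(Q_Γ)_g` a domain, `Γ` saturated on the chart, `(Q_Γ)_g` not a regular ring,
`¬ dim ≤ 1`) has a resolution, then `MatroidCellRes` holds: `matroidCellRes_of_chartEngine`, the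
regular charts being their own resolution and the charts of dimension `≤ 1` being resolved by
normalisation. The hypothesis is the honest residue of the crux — Hu's Thm. 1.3 (integral
Γ-schemes) LOCALISED to charts, with no hypothesis on the whole `Z_Γ`; it is implied by the summit
(`saturatedEngine_of_resolutionOfSingularities`) and, by Lafforgue universality, it is local
resolution of every finite-type `𝔽_p`-scheme up to a factor `𝔸ʳ`.
[cite: Hu2025, Thm. 1.3 (p. 8) and Lemma 7.3 (p. 58); Lafforgue2003, Thm. I.14] -/
theorem matroidCellRes_of_saturatedEngine
    (hE : ∀ p : ℕ, p.Prime → ∀ (m : ℕ) (Γ : Set (Fin 3 → Fin 3 ⊕ Fin m))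
      (g : MvPolynomial (Fin 3 × Fin m) (ZMod p) ⧸ minorIdeal p m Γ),
      IsDomain (Localization.Away g) →
        (∀ u : Fin 3 → Fin 3 ⊕ Fin m, u ∉ Γ →
          algebraMap (MvPolynomial (Fin 3 × Fin m) (ZMod p) ⧸ minorIdeal p m Γ)
            (Localization.Away g)
            (Ideal.Quotient.mk (minorIdeal p m Γ) ((tautMatrix p m).submatrix id u).det) ≠ 0) →
        ¬ IsRegularRing (Localization.Away g) →
          ¬ topologicalKrullDim (Spec (.of (Localization.Away g))) ≤ 1 →
            Scheme.HasResolution (Spec (.of (Localization.Away g)))) :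
    MatroidCellRes := by
  refine matroidCellRes_of_chartEngine fun p hp m Γ g hdom hsat => ?_
  haveI : Fact p.Prime := ⟨hp⟩
  by_cases hreg : IsRegularRing (Localization.Away g)
  · exact hasResolution_Spec_of_isRegularRing hreg
  by_cases hdim1 : topologicalKrullDim (Spec (.of (Localization.Away g))) ≤ 1
  · exact hasResolution_away_of_dim_le_one p m (minorIdeal p m Γ) g hdom hdim1
  · exact hE p hp m Γ g hdom hsat hreg hdim1

/-- **The saturated engine is summit-implied** (so it is an honest residue, not a refutable
artefact: no `¬` of it exists short of `¬ ResolutionOfSingularities`): the summit resolves every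
integral principal chart outright (`hasResolution_away_of_resolutionOfSingularities`), ignoring
saturation, singularity and dimension. [folklore] -/
theorem saturatedEngine_of_resolutionOfSingularities (hS : _root_.ResolutionOfSingularities) :
    ∀ p : ℕ, p.Prime → ∀ (m : ℕ) (Γ : Set (Fin 3 → Fin 3 ⊕ Fin m))
      (g : MvPolynomial (Fin 3 × Fin m) (ZMod p) ⧸ minorIdeal p m Γ),
      IsDomain (Localization.Away g) →
        (∀ u : Fin 3 → Fin 3 ⊕ Fin m, u ∉ Γ →
          algebraMap (MvPolynomial (Fin 3 × Fin m) (ZMod p) ⧸ minorIdeal p m Γ)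
            (Localization.Away g)
            (Ideal.Quotient.mk (minorIdeal p m Γ) ((tautMatrix p m).submatrix id u).det) ≠ 0) →
        ¬ IsRegularRing (Localization.Away g) →
          ¬ topologicalKrullDim (Spec (.of (Localization.Away g))) ≤ 1 →
            Scheme.HasResolution (Spec (.of (Localization.Away g))) :=
  fun p hp m Γ g hdom _ _ _ =>
    hasResolution_away_of_resolutionOfSingularities hS p hp m (minorIdeal p m Γ) g hdom

end Summit.ResolutionOfSingularities.ResolutionOfSingularities.Theorems.MatroidCellRes

end
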